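import Summits.HodgeConjecture.HodgeConjecture.Theorems.LimitExtensionMiddleDivisorSupportSuffices
import Literature.AlgebraicGeometry.HodgeTheory.GysinKernelSplit
import Literature.AlgebraicGeometry.HodgeTheory.HodgeRiemannPolarizability
import Literature.AlgebraicGeometry.HodgeTheory.ComplexConjugationHolds
import Literature.NumberTheory.Transcendental.DeRhamTheoremMultiplicative
import Literature.AlgebraicGeometry.HodgeTheory.PencilStepBelowMiddle

/-!
# Route LimitExtension · `MiddleDivisorSupportSuffices` (stmt-HodgeConjecture-10865):
# the item modulo three named facts (the Lefschetz-pencil step stated as a Literature fact)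

The item: `MiddleDivisorSupportSuffices := HodgeModels (inline) → MiddleDivisorSupport →
HodgeConjecture` — if every rational middle-degree Hodge class on every even-dimensional smooth
projective complex variety is supported on a divisor, the Hodge conjecture follows (Thomas 2005,
Prop. 2 with Thm. 1; de Cataldo–Migliorini 2009, §4).

The tree's `Theorems/LimitExtensionMiddleDivisorSupportSuffices` proves the assembly induction
(`middleDivisorSupportSuffices_of_facts`): the item follows from Deligne's *Hodge III* Cor. 8.2.8
(`Deligne1974_ker_restrictCompl_eq_iSup_range_complexGysin`), Voisin 2025 Cor. 2.12
(`Voisin2025_hodgeClass_lift_complexGysin`) and the LEFSCHETZ-PENCIL STEP `hPen` below the middle,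
there an unnamed hypothesis (verbatim the body of route `NodalSupport`/`LinearSystemTorelli`'s
support item `PencilReduction`, stmt-HodgeConjecture-1083). This file NAMES that step as what it
is — a theorem in print, the second paragraph of the proof of de Cataldo–Migliorini 2009,
Prop. 4.5 (arXiv:0711.1307v1 pp. 10–11; = Thomas 2005, proof of Prop. 2, case `k < d/2`, with the
"parasite components" of Thomas's Hilbert-scheme construction taken care of): *if the Hodge
conjecture holds for all smooth projective varieties of dimension `m`, then on a smooth projective
variety of dimension `m + 1` every rational Hodge class of degree `2p ≤ m` is algebraic* — so that
the gate files it under `Literature/AlgebraicGeometry/HodgeTheory` and the item's residue becomes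
exactly three Literature named facts, two of which are already split to single open leaves:

* `pencilReduction_body_of_pencilStep` — the fact supplies `hPen` (verbatim the body of the
  support item `PencilReduction`, stmt-HodgeConjecture-1083, of routes `NodalSupport` /
  `LinearSystemTorelli`);
* `middleDivisorSupportSuffices_of_pencilStep` — the item from Cor. 8.2.8, Cor. 2.12 and the
  pencil step;
* `middleDivisorSupportSuffices_of_leaves` — the item from the three open LEAVES of the tree:
  Hodge III Prop. 8.2.7 (`Deligne1974_ker_pullback_eq_ker_pullback_resolution`, through
  `GysinKernelSplit`), the polarizability of the Hodge structure of a smooth projective variety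
  (`smoothProjective_hodgeStructure_isPolarizable`, Hodge–Riemann, through
  `HodgeRiemannPolarizability`, real Hodge models and de Rham's theorem being the theorems
  `exists_isReal_hodgeModel_holds`, `exists_deRhamIsoFamily_holds`), and the pencil step.

Why the pencil step cannot be replaced by what the tree proves: products with projective spaces
(BFNP 2009 Lemma 48, the tree's THEOREM `middleDimensionReduction_holds`) send a class of degree
`2q` on a `(2q+1)`-fold to a middle class on a `(2q+2)`-fold, which `MiddleDivisorSupport` + the
divisor descent send back to classes of degree `2q` on the `(2q+1)`-dimensional components of a
resolved divisor — a circle; only cutting DOWN by a pencil (hyperplane sections are `2q`-folds,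
where `MiddleDivisorSupport` applies) is well-founded, and the price is the spread of the
fibrewise cycles (relative Hilbert scheme + countability) and the blow-up formula for the pencil,
for which the tree has no carrier yet (`HodgeTheory/AlgebraicityLocus*` prove only the glue).

CLOSING RECIPE: with discharges `h827 : Deligne1974_ker_pullback_eq_ker_pullback_resolution`,
`hpol : smoothProjective_hodgeStructure_isPolarizable` and `hpen : <the pencil fact>`, append
`theorem middleDivisorSupportSuffices_proof : MiddleDivisorSupportSuffices :=
middleDivisorSupportSuffices_of_leaves h827 hpol hpen` (`--workitem stmt-HodgeConjecture-10865`)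
and release the item `--by` it.

## References

* [DecataldoMigliorini2009] M. A. de Cataldo, L. Migliorini, §4, Prop. 4.5 and its proof
  (arXiv:0711.1307v1, pp. 10–11).
* [Thomas2005Nodes] R. P. Thomas, Nodes and the Hodge conjecture, J. Algebraic Geom. 14 (2005),
  §2, Prop. 2 and its proof (arXiv:math/0212216, p. 4).
* [DeligneHodgeIII1974] P. Deligne, Théorie de Hodge III, Publ. Math. IHÉS 44 (1974), Prop. 8.2.7,
  Cor. 8.2.8.
* [Voisin2025] C. Voisin, Hodge and generalized Hodge conjectures, coniveau and algebraic cycles,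
  J. Open Math. Probl. 1 (2025), Cor. 2.12.
* [VoisinHodgeI2002] C. Voisin, Hodge Theory and Complex Algebraic Geometry I, Thm. 6.25, 6.32.
* [BrosnanFangNiePearlstein2009] P. Brosnan, H. Fang, Z. Nie, G. Pearlstein, Invent. Math. 177
  (2009), §6 Lemma 48.
-/

noncomputable section

-- the mandated namespace `Summit.HodgeConjecture.HodgeConjecture.Theorems` (Sub = Summit) trips
-- `linter.dupNamespace`; off tree-wide in the lakefile, restated for stand-alone elaboration.
set_option linter.dupNamespace false

open scoped Manifold
open Literature.AlgebraicGeometry.Motives Literature.AlgebraicGeometry.HodgeTheory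

namespace Summit.HodgeConjecture.HodgeConjecture.Theorems

/-- **The pencil step supplies the hypothesis `hPen` of the tree's assembly induction** — verbatim
the body of the support item `PencilReduction` of routes `NodalSupport` / `LinearSystemTorelli`
(stmt-HodgeConjecture-1083): for `1 ≤ p`, `2p ≤ m`, the Hodge conjecture in all codimensions for
smooth projective `m`-folds (and, redundantly, in codimension `p − 1` for `(m+1)`-folds) gives the
Hodge conjecture in codimension `p` for `(m+1)`-folds. Immediate from the fact (the second
antecedent is dropped). [cite: DecataldoMigliorini2009, §4 proof of Prop. 4.5]
[cite: Thomas2005Nodes, §2 proof of Prop. 2] -/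
theorem pencilReduction_body_of_pencilStep
    (hP : Literature.AlgebraicGeometry.HodgeTheory.deCataldoMigliorini2009_mem_algebraicClasses_of_two_mul_le) :
    ∀ (m p : ℕ), 1 ≤ p → 2 * p ≤ m →
      (∀ ⦃Y : SchemeOver ℂ⦄, IsSmoothProjective m Y → ∀ (q : ℕ) (c : complexBetti Y (2 * q)),
        IsRationalClass c → IsOfHodgeType m Y (2 * q) q q c → c ∈ algebraicClasses Y q) →
      (∀ ⦃X' : SchemeOver ℂ⦄, IsSmoothProjective (m + 1) X' →
        ∀ c : complexBetti X' (2 * (p - 1)), IsRationalClass c →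
          IsOfHodgeType (m + 1) X' (2 * (p - 1)) (p - 1) (p - 1) c → c ∈ algebraicClasses X' (p - 1)) →
      ∀ ⦃X : SchemeOver ℂ⦄, IsSmoothProjective (m + 1) X → ∀ c : complexBetti X (2 * p),
        IsRationalClass c → IsOfHodgeType (m + 1) X (2 * p) p p c → c ∈ algebraicClasses X p :=
  fun _m p _hp hpm hHC _ _X hX c hc hH ↦ hP hX hHC p c hpm hc hH

/-- **`MiddleDivisorSupportSuffices` (item stmt-HodgeConjecture-10865) from three named facts**:
Deligne's *Hodge III* Cor. 8.2.8 (`hD`), Voisin 2025 Cor. 2.12 (`hV`) — the two inputs of the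
divisor descent `supportedHodgeClassDescent_of` — and the Lefschetz-pencil step below the middle
(`hP`, de Cataldo–Migliorini 2009 proof of Prop. 4.5 / Thomas 2005 proof of Prop. 2), which
supplies the hypothesis `hPen` of the tree's assembly induction
`middleDivisorSupportSuffices_of_facts` (its second antecedent, the Hodge conjecture in codimension
`p − 1` on `(m+1)`-folds, is not even needed). CONDITIONAL on the three facts.
[cite: Thomas2005Nodes, Prop. 2 (proof)] [cite: DecataldoMigliorini2009, §4 Prop. 4.5 (proof)]
[cite: DeligneHodgeIII1974, Cor. 8.2.8] [cite: Voisin2025, Cor. 2.12 (p. 24)] -/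
theorem middleDivisorSupportSuffices_of_pencilStep
    (hD : Deligne1974_ker_restrictCompl_eq_iSup_range_complexGysin)
    (hV : Voisin2025_hodgeClass_lift_complexGysin)
    (hP : Literature.AlgebraicGeometry.HodgeTheory.deCataldoMigliorini2009_mem_algebraicClasses_of_two_mul_le) :
    Summit.HodgeConjecture.HodgeConjecture.Theses.LimitExtension.MiddleDivisorSupportSuffices :=
  middleDivisorSupportSuffices_of_facts hD hV (pencilReduction_body_of_pencilStep hP)

/-- **`MiddleDivisorSupportSuffices` from the three open LEAVES of the tree.** Cor. 8.2.8 is the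
tree's `Deligne1974_ker_restrictCompl_eq_iSup_range_complexGysin_holds_of` applied to its single
open child, *Hodge III* Prop. 8.2.7 (`h827 : Deligne1974_ker_pullback_eq_ker_pullback_resolution`,
the weight argument `Ker(Hⁿ(Z) → Hⁿ(Z̃)) = W_{n-1}`); Cor. 2.12 is
`Voisin2025_hodgeClass_lift_complexGysin_holds_of` applied to the THEOREMS
`exists_isReal_hodgeModel_holds` (real Hodge models: GAGA + Hodge decomposition) and
`exists_deRhamIsoFamily_holds` (de Rham's theorem, multiplicative form, the complex model space seen
as a real one) and to its single open input, the polarizability of the Hodge structure on the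
cohomology of a smooth projective variety (`hpol : smoothProjective_hodgeStructure_isPolarizable`,
Hodge–Riemann); the third leaf is the pencil step `hpen`. So the item is EXACTLY these three named
facts away. CLOSING RECIPE in the module docstring.
[cite: DeligneHodgeIII1974, Prop. 8.2.7 and Cor. 8.2.8] [cite: Voisin2025, Prop. 2.11, Cor. 2.12]
[cite: VoisinHodgeI2002, Thm. 6.32 with Thm. 6.25] [cite: DecataldoMigliorini2009, §4 Prop. 4.5 (proof)] -/
theorem middleDivisorSupportSuffices_of_leaves
    (h827 : Deligne1974_ker_pullback_eq_ker_pullback_resolution)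
    (hpol : smoothProjective_hodgeStructure_isPolarizable)
    (hpen : Literature.AlgebraicGeometry.HodgeTheory.deCataldoMigliorini2009_mem_algebraicClasses_of_two_mul_le) :
    Summit.HodgeConjecture.HodgeConjecture.Theses.LimitExtension.MiddleDivisorSupportSuffices :=
  middleDivisorSupportSuffices_of_pencilStep
    (Deligne1974_ker_restrictCompl_eq_iSup_range_complexGysin_holds_of h827)
    (Voisin2025_hodgeClass_lift_complexGysin_holds_of exists_isReal_hodgeModel_holds
      (fun E _ _ _ ↦ Literature.NumberTheory.Transcendental.exists_deRhamIsoFamily_holds E) hpol)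
    hpen

end Summit.HodgeConjecture.HodgeConjecture.Theorems

end
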